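import Summits.QuantumFields.YangMills.Theorems.NPointIsotropy.Negative.HyperoctahedralPlane
import Literature.MathematicalPhysics.QuantumFieldTheory.OSData

/-!
# Negative results on `PencilRigidity.NPointIsotropy`, II: the junk one-species family

Support file 2/4 (stmt-QuantumFields-11686). The junk family `𝔖₀ = 1`, `𝔖₄ = J`, `𝔖ₙ = 0` otherwise,
where `J = Σ_{g ∈ W(B₄)} Σ_{π ∈ S₄} λ ∘ permTest π ∘ linActMulti g⁻¹` and `λ F = ∫_{ℝ⁷} F (A y) dy`, and the
VANISHING MECHANISM: `J` kills every test function vanishing at configurations two of whose points have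
equal pairing with a vector `w` all of whose `W(B₄)`-preimages vanish in coordinate `3`, `2` or `0` — in
particular every `θF* ⊗ G` with `F, G` time-ordered in ANY frame `R` with `R e₀ ∈ span(e₀, e₁)`. Hence the
junk family satisfies E0, E0h, E2 (in every such frame), E4 and `HasMassGap Δ` for every `Δ`, all with
vanishing clustered quantities.
-/

noncomputable section

-- Mathlib's `SimplexCategory` instance `Fintype (Fin (x.len + 1))` matches `Fintype (Fin 4)` and makes concrete
-- `Fin 4` instance paths diverge between elaborations (tree-known workaround, cf.
-- `Literature/Geometry/Riemannian/PieceMetricLocalExtension.lean`).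
attribute [-instance] SimplexCategory.instFintypeToTypeOrderHomFinHAddNatLenOfNat

namespace Summit.QuantumFields.YangMills.Theorems.NPointIsotropy.Negative

open scoped BigOperators ComplexConjugate InnerProductSpace
open MeasureTheory Filter Topology
open Literature.MathematicalPhysics.QuantumLattice Literature.MathematicalPhysics.AQFT
  Literature.MathematicalPhysics.QuantumFieldTheory

/-- `λ F = ∫_{ℝ⁷} F (A y) dy` as a continuous linear functional. -/
def lam : SchwartzMap (Fin 4 → E4) ℂ →L[ℂ] ℂ :=
  (SchwartzMap.integralCLM ℂ (volume : Measure D7)).comp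
    (SchwartzMap.compCLM ℂ (g := (A : D7 → (Fin 4 → E4))) A.hasTemperateGrowth A_upper)

/-- Unfolding `λ`. -/
theorem lam_apply (F : SchwartzMap (Fin 4 → E4) ℂ) : lam F = ∫ y : D7, F (A y) := by
  simp only [lam, ContinuousLinearMap.comp_apply, SchwartzMap.integralCLM_apply]
  congr 1

/-- **The junk four-point functional**: the `W(B₄) × S₄`-symmetrisation of `λ`. -/
def J : SchwartzMap (Fin 4 → E4) ℂ →L[ℂ] ℂ :=
  ∑ g : WIdx, ∑ π : Equiv.Perm (Fin 4),
    (lam.comp (permTest π)).comp (linActMulti (sp g.1 g.2).symm)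

/-- Unfolding `J` as a double sum of integrals over the 7-plane. -/
theorem J_apply (F : SchwartzMap (Fin 4 → E4) ℂ) :
    J F = ∑ g : WIdx, ∑ π : Equiv.Perm (Fin 4),
      ∫ y : D7, F (fun i => sp g.1 g.2 (A y (π i))) := by
  simp only [J, _root_.sum_apply, ContinuousLinearMap.comp_apply,
    lam_apply, permTest_apply, linActMulti_apply, LinearIsometryEquiv.symm_symm]
  rfl

/-- **The junk one-species family**: `𝔖₀ = 1`, `𝔖₄ = J`, all other `𝔖ₙ = 0`. -/
def junk : SchwingerFamily E4
  | 0 => LabelledSchwingerFamily.evalAt (0 : Fin 0 → E4)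
  | 4 => J
  | _ => 0

/-- Degree four of the junk family is `J`. -/
theorem junk_four : junk 4 = J := rfl

/-- Degree zero of the junk family is evaluation (at the unique empty configuration). -/
theorem junk_apply_of_eq_zero {N : ℕ} (hN : N = 0) (K : SchwartzMap (Fin N → E4) ℂ)
    (x : Fin N → E4) : junk N K = K x := by
  subst hN
  show LabelledSchwingerFamily.evalAt (0 : Fin 0 → E4) K = K x
  rw [LabelledSchwingerFamily.evalAt_apply]
  congr 1
  exact Subsingleton.elim _ _

/-- All degrees other than `0` and `4` vanish. -/
theorem junk_of_ne {N : ℕ} (h0 : N ≠ 0) (h4 : N ≠ 4) : junk N = 0 := by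
  rcases N with _ | _ | _ | _ | _ | N
  · exact absurd rfl h0
  · rfl
  · rfl
  · rfl
  · exact absurd rfl h4
  · rfl

/-! ### The vanishing mechanism -/

/-- **Core vanishing lemma.** If every `W(B₄)`-preimage of `w` vanishes in coordinate `3`, `2` or
`0`, then `J` kills every test function vanishing at configurations two of whose points have the same
pairing with `w`. -/
theorem J_eq_zero_of_vanish (H : SchwartzMap (Fin 4 → E4) ℂ) (w : E4)
    (hw : ∀ (σ : Equiv.Perm (Fin 4)) (ε : Fin 4 → Bool),
      ((sp σ ε).symm w) 3 = 0 ∨ ((sp σ ε).symm w) 2 = 0 ∨ ((sp σ ε).symm w) 0 = 0)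
    (hH : ∀ z : Fin 4 → E4, (∃ p q : Fin 4, p ≠ q ∧ ⟪z p, w⟫_ℝ = ⟪z q, w⟫_ℝ) → H z = 0) :
    J H = 0 := by
  rw [J_apply]
  refine Finset.sum_eq_zero fun g _ => Finset.sum_eq_zero fun π _ => ?_
  have hz : (fun y : D7 => H (fun i => sp g.1 g.2 (A y (π i)))) = fun _ => 0 := by
    funext y
    apply hH
    obtain ⟨p, q, hpq, hinner⟩ := exists_pair_inner_eq y ((sp g.1 g.2).symm w) (hw g.1 g.2)
    refine ⟨π.symm p, π.symm q, fun h => hpq (π.symm.injective h), ?_⟩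
    simp only [Equiv.apply_symm_apply]
    rwa [← LinearIsometryEquiv.inner_map_map (sp g.1 g.2) (A y p),
      ← LinearIsometryEquiv.inner_map_map (sp g.1 g.2) (A y q),
      LinearIsometryEquiv.apply_symm_apply] at hinner
  rw [hz]
  simp

/-- The same for the whole family in every positive degree. -/
theorem junk_eq_zero_of_vanish {N : ℕ} (hN : N ≠ 0) (H : SchwartzMap (Fin N → E4) ℂ) (w : E4)
    (hw : ∀ (σ : Equiv.Perm (Fin 4)) (ε : Fin 4 → Bool),
      ((sp σ ε).symm w) 3 = 0 ∨ ((sp σ ε).symm w) 2 = 0 ∨ ((sp σ ε).symm w) 0 = 0)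
    (hH : ∀ z : Fin N → E4, (∃ p q : Fin N, p ≠ q ∧ ⟪z p, w⟫_ℝ = ⟪z q, w⟫_ℝ) → H z = 0) :
    junk N H = 0 := by
  rcases N with _ | _ | _ | _ | _ | N
  · exact absurd rfl hN
  · rfl
  · rfl
  · rfl
  · exact J_eq_zero_of_vanish H w hw hH
  · rfl

/-- The `W(B₄)`-preimages of a vector of the `(e₀,e₁)`-plane satisfy the hypothesis of the core
vanishing lemma (restated). -/
theorem planar_hw (R : E4 ≃ₗᵢ[ℝ] E4) (a b : ℝ)
    (hR : R (EuclideanSpace.single 0 1) = a • EuclideanSpace.single 0 1 + b • EuclideanSpace.single 1 1) :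
    ∀ (σ : Equiv.Perm (Fin 4)) (ε : Fin 4 → Bool),
      ((sp σ ε).symm (R (EuclideanSpace.single 0 1))) 3 = 0 ∨
      ((sp σ ε).symm (R (EuclideanSpace.single 0 1))) 2 = 0 ∨
      ((sp σ ε).symm (R (EuclideanSpace.single 0 1))) 0 = 0 := by
  intro σ ε
  rw [hR]
  exact sp_symm_planar_coord_zero σ ε a b

/-- Time coordinate as a pairing with `e₀`. -/
theorem inner_e0 (z : E4) : ⟪z, EuclideanSpace.single 0 1⟫_ℝ = z 0 := by
  rw [EuclideanSpace.inner_single_right]; simp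

/-- Time coordinate of `R⁻¹ v` is the pairing with `R e₀`. -/
theorem symm_apply_zero (R : E4 ≃ₗᵢ[ℝ] E4) (v : E4) :
    (R.symm v) 0 = ⟪v, R (EuclideanSpace.single 0 1)⟫_ℝ := by
  rw [← inner_e0, ← LinearIsometryEquiv.inner_map_map R (R.symm v), LinearIsometryEquiv.apply_symm_apply]

/-- Pointwise shadow of time-ordering: a non-zero value forces positive, strictly increasing times. -/
def TimeSep {n : ℕ} (F : SchwartzMap (Fin n → E4) ℂ) : Prop :=
  ∀ u : Fin n → E4, F u ≠ 0 → (∀ i, 0 < u i 0) ∧ StrictMono fun i => u i 0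

/-- Time-ordered test functions are time-separated pointwise. -/
theorem timeSep_of_isTimeOrdered {n : ℕ} {F : SchwartzMap (Fin n → E4) ℂ} (hF : IsTimeOrdered F) :
    TimeSep F :=
  fun _ hu => hF (subset_tsupport _ (Function.mem_support.2 hu))

/-- Time separation survives translation by a vector with non-negative time component. -/
theorem TimeSep.translate {n : ℕ} {F : SchwartzMap (Fin n → E4) ℂ} (hF : TimeSep F) (a : E4)
    (ha : 0 ≤ a 0) : TimeSep (translateMulti a F) := by
  intro u hu
  rw [translateMulti_apply] at hu
  obtain ⟨hpos, hmono⟩ := hF _ hu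
  refine ⟨fun i => ?_, fun i j hij => ?_⟩
  · have := hpos i
    simp only [PiLp.sub_apply] at this
    linarith
  · have := hmono hij
    simp only [PiLp.sub_apply] at this
    linarith

/-- A time-separated function vanishes where two times coincide. -/
theorem TimeSep.apply_eq_zero {n : ℕ} {F : SchwartzMap (Fin n → E4) ℂ} (hF : TimeSep F)
    (z : Fin n → E4) (hz : ∃ p q : Fin n, p ≠ q ∧ z p 0 = z q 0) : F z = 0 := by
  by_contra hne
  obtain ⟨-, hmono⟩ := hF z hne
  obtain ⟨p, q, hpq, h⟩ := hz
  exact hpq (hmono.injective h)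

/-- … and so does its OS adjoint. -/
theorem TimeSep.osAdjoint_apply_eq_zero {n : ℕ} {F : SchwartzMap (Fin n → E4) ℂ} (hF : TimeSep F)
    (z : Fin n → E4) (hz : ∃ p q : Fin n, p ≠ q ∧ z p 0 = z q 0) : osAdjoint F z = 0 := by
  rw [osAdjoint_apply, map_eq_zero]
  by_contra hne
  obtain ⟨-, hmono⟩ := hF _ hne
  obtain ⟨p, q, hpq, h⟩ := hz
  apply hpq
  have hinj := hmono.injective
  have key : (fun i : Fin n => (timeReflection 4 (z (Fin.rev i))) 0) (Fin.rev p) =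
      (fun i : Fin n => (timeReflection 4 (z (Fin.rev i))) 0) (Fin.rev q) := by
    simp only [timeReflection_apply, Fin.rev_rev, h]
  exact Fin.rev_injective (hinj key)

/-- **(L2)** A tensor `θF* ⊗ G` of time-separated `F, G` vanishes where two times coincide. -/
theorem append_apply_eq_zero {n m : ℕ} {F : SchwartzMap (Fin n → E4) ℂ}
    {G : SchwartzMap (Fin m → E4) ℂ} (hF : TimeSep F) (hG : TimeSep G)
    {H : SchwartzMap (Fin (n + m) → E4) ℂ} (hH : IsAppendTensorOf H (osAdjoint F) G)
    (z : Fin (n + m) → E4) (hz : ∃ p q : Fin (n + m), p ≠ q ∧ z p 0 = z q 0) : H z = 0 := by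
  rw [hH z]
  by_contra hne
  have hF0 : osAdjoint F (z ∘ Fin.castAdd m) ≠ 0 := left_ne_zero_of_mul hne
  have hG0 : G (z ∘ Fin.natAdd n) ≠ 0 := right_ne_zero_of_mul hne
  rw [osAdjoint_apply, map_ne_zero] at hF0
  obtain ⟨hFpos, hFmono⟩ := hF _ hF0
  obtain ⟨hGpos, hGmono⟩ := hG _ hG0
  have tneg : ∀ a : Fin n, z (Fin.castAdd m a) 0 < 0 := fun a => by
    have := hFpos (Fin.rev a)
    simp [timeReflection_apply, Fin.rev_rev] at this
    linarith
  have tpos : ∀ b : Fin m, 0 < z (Fin.natAdd n b) 0 := fun b => by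
    have := hGpos b
    simpa using this
  have tinjF : ∀ a a' : Fin n, z (Fin.castAdd m a) 0 = z (Fin.castAdd m a') 0 → a = a' := by
    intro a a' h
    have hinj := hFmono.injective
    have key : (fun i : Fin n => (timeReflection 4 ((z ∘ Fin.castAdd m) (Fin.rev i))) 0) (Fin.rev a) =
        (fun i : Fin n => (timeReflection 4 ((z ∘ Fin.castAdd m) (Fin.rev i))) 0) (Fin.rev a') := by
      simp only [Function.comp_apply, timeReflection_apply, Fin.rev_rev, h]
    exact Fin.rev_injective (hinj key)
  have tinjG : ∀ b b' : Fin m, z (Fin.natAdd n b) 0 = z (Fin.natAdd n b') 0 → b = b' := by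
    intro b b' h
    have hinj := hGmono.injective
    exact hinj (by simpa using h)
  obtain ⟨p, q, hpq, h⟩ := hz
  induction p using Fin.addCases with
  | left a =>
    induction q using Fin.addCases with
    | left a' => exact hpq (by rw [tinjF a a' h])
    | right b' => exact absurd (h ▸ tneg a) (not_lt.2 (tpos b').le)
  | right b =>
    induction q using Fin.addCases with
    | left a' => exact absurd (h.symm ▸ tneg a') (not_lt.2 (tpos b).le)
    | right b' => exact hpq (by rw [tinjG b b' h])

/-! ### The OS clauses of the junk family -/

/-- **Reflection positivity in pull-back form for EVERY frame with `R e₀ ∈ span(e₀, e₁)`** (in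
particular the eight frames of the crux and `R = 1`): only the degree-`0` block survives. -/
theorem junk_frame_rp (R : E4 ≃ₗᵢ[ℝ] E4) (a b : ℝ)
    (hR : R (EuclideanSpace.single 0 1) = a • EuclideanSpace.single 0 1 + b • EuclideanSpace.single 1 1) :
    (SchwingerFamily.toLabelled (fun n => (junk n).comp (linActMulti R))).IsReflectionPositive := by
  intro N deg lab F hF H hH
  classical
  let c : Fin N → ℂ := fun j => if deg j = 0 then F j (fun _ => 0) else 0
  have hterm : ∀ i j, (SchwingerFamily.toLabelled fun n => (junk n).comp (linActMulti R))
      (deg i + deg j) (Fin.append (lab i ∘ Fin.rev) (lab j)) (H i j) = conj (c i) * c j := by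
    intro i j
    simp only [SchwingerFamily.toLabelled_apply, ContinuousLinearMap.comp_apply]
    by_cases hij : deg i + deg j = 0
    · have hi : deg i = 0 := by omega
      have hj : deg j = 0 := by omega
      haveI : IsEmpty (Fin (deg i)) := by rw [hi]; infer_instance
      haveI : IsEmpty (Fin (deg j)) := by rw [hj]; infer_instance
      have key : ∀ (u u' : Fin (deg i) → E4) (v v' : Fin (deg j) → E4),
          conj (F i u) * F j v = conj (F i u') * F j v' := by
        intro u u' v v'
        rw [Subsingleton.elim u u', Subsingleton.elim v v']
      rw [junk_apply_of_eq_zero hij _ (fun _ => 0), linActMulti_apply, hH i j, osAdjoint_apply]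
      simp only [c, if_pos hi, if_pos hj]
      exact key _ _ _ _
    · have hzero : junk (deg i + deg j) (linActMulti R (H i j)) = 0 := by
        refine junk_eq_zero_of_vanish hij _ (R (EuclideanSpace.single 0 1)) (planar_hw R a b hR) ?_
        intro z hz
        rw [linActMulti_apply]
        apply append_apply_eq_zero (timeSep_of_isTimeOrdered (hF i)) (timeSep_of_isTimeOrdered (hF j))
          (hH i j)
        obtain ⟨p, q, hpq, h⟩ := hz
        exact ⟨p, q, hpq, by rw [symm_apply_zero, symm_apply_zero, h]⟩
      rw [hzero]
      rcases Nat.eq_zero_or_pos (deg i) with hi | hi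
      · have hj : deg j ≠ 0 := by omega
        simp [c, hj]
      · simp [c, hi.ne']
  have hsum : ∑ i, ∑ j, conj (c i) * c j = conj (∑ i, c i) * ∑ j, c j := by
    rw [map_sum, Finset.sum_mul]
    refine Finset.sum_congr rfl fun i _ => ?_
    rw [Finset.mul_sum]
  simp only [hterm]
  rw [hsum, mul_comm, Complex.mul_conj, Complex.ofReal_re, Complex.ofReal_im]
  exact ⟨Complex.normSq_nonneg _, rfl⟩

/-- Pulling back by the identity frame is the identity. -/
theorem linActMulti_refl {n : ℕ} :
    (linActMulti (LinearIsometryEquiv.refl ℝ E4) : SchwartzMap (Fin n → E4) ℂ →L[ℂ] _) =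
      ContinuousLinearMap.id ℂ _ := by
  ext F x
  simp only [linActMulti_apply, ContinuousLinearMap.coe_id', id_eq]
  rfl

/-- E2 of the junk family itself (the frame `R = 1`). -/
theorem junk_rp : junk.toLabelled.IsReflectionPositive := by
  have h := junk_frame_rp (LinearIsometryEquiv.refl ℝ E4) 1 0 (by simp)
  have hfam : (fun n => (junk n).comp (linActMulti (LinearIsometryEquiv.refl ℝ E4))) = junk := by
    funext n
    rw [linActMulti_refl, ContinuousLinearMap.comp_id]
  rw [hfam] at h
  exact h

/-- `e₀ = 1 • e₀ + 0 • e₁` (the frame `R = 1`). -/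
theorem e0_planar : (LinearIsometryEquiv.refl ℝ E4) (EuclideanSpace.single 0 1) =
    (1 : ℝ) • EuclideanSpace.single 0 1 + (0 : ℝ) • EuclideanSpace.single 1 1 := by simp

/-- `junk N` kills time-separated functions (`N ≠ 0`). -/
theorem junk_timeSep_eq_zero {N : ℕ} (hN : N ≠ 0) {F : SchwartzMap (Fin N → E4) ℂ}
    (hF : TimeSep F) : junk N F = 0 := by
  refine junk_eq_zero_of_vanish hN F _ (planar_hw _ 1 0 e0_planar) fun z hz => hF.apply_eq_zero z ?_
  obtain ⟨p, q, hpq, h⟩ := hz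
  exact ⟨p, q, hpq, by simpa [inner_e0] using h⟩

/-- `junk N` kills OS adjoints of time-separated functions (`N ≠ 0`). -/
theorem junk_osAdjoint_timeSep_eq_zero {N : ℕ} (hN : N ≠ 0) {F : SchwartzMap (Fin N → E4) ℂ}
    (hF : TimeSep F) : junk N (osAdjoint F) = 0 := by
  refine junk_eq_zero_of_vanish hN _ _ (planar_hw _ 1 0 e0_planar) fun z hz =>
    hF.osAdjoint_apply_eq_zero z ?_
  obtain ⟨p, q, hpq, h⟩ := hz
  exact ⟨p, q, hpq, by simpa [inner_e0] using h⟩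

/-- `junk (n+m)` kills `θF* ⊗ G` for time-separated `F, G` (`n + m ≠ 0`). -/
theorem junk_append_eq_zero {n m : ℕ} (hnm : n + m ≠ 0) {F : SchwartzMap (Fin n → E4) ℂ}
    {G : SchwartzMap (Fin m → E4) ℂ} (hF : TimeSep F) (hG : TimeSep G)
    {H : SchwartzMap (Fin (n + m) → E4) ℂ} (hH : IsAppendTensorOf H (osAdjoint F) G) :
    junk (n + m) H = 0 := by
  refine junk_eq_zero_of_vanish hnm _ _ (planar_hw _ 1 0 e0_planar) fun z hz =>
    append_apply_eq_zero hF hG hH z ?_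
  obtain ⟨p, q, hpq, h⟩ := hz
  exact ⟨p, q, hpq, by simpa [inner_e0] using h⟩

/-- E0 (normalisation) for the junk family. -/
theorem junk_isNormalized : junk.toLabelled.IsNormalized := by
  intro k F
  simp only [SchwingerFamily.toLabelled_apply]
  exact junk_apply_of_eq_zero rfl F _

/-- E0 (hermiticity) for the junk family: both sides vanish in positive degree. -/
theorem junk_isHermitian : junk.toLabelled.IsHermitian := by
  intro n k F hF
  simp only [SchwingerFamily.toLabelled_apply]
  rcases Nat.eq_zero_or_pos n with rfl | hn
  · rw [junk_apply_of_eq_zero rfl F 0, junk_apply_of_eq_zero rfl _ 0, osAdjoint_apply, Complex.conj_conj]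
    congr 1
    exact Subsingleton.elim _ _
  · rw [junk_timeSep_eq_zero hn.ne' (timeSep_of_isTimeOrdered hF),
      junk_osAdjoint_timeSep_eq_zero hn.ne' (timeSep_of_isTimeOrdered hF), map_zero]

/-- E4 (cluster property) for the junk family: every clustered quantity is identically `0`. -/
theorem junk_hasClusterProperty : junk.toLabelled.HasClusterProperty := by
  intro n m k k' F G hF hG a ha0 _ H hH
  simp only [SchwingerFamily.toLabelled_apply]
  have hzero : ∀ t, junk (n + m) (H t) - junk n (osAdjoint F) * junk m G = 0 := by
    intro t
    rcases Nat.eq_zero_or_pos (n + m) with hnm | hnm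
    · obtain ⟨rfl, rfl⟩ : n = 0 ∧ m = 0 := by omega
      haveI : IsEmpty (Fin (0 + 0)) := (inferInstance : IsEmpty (Fin 0))
      rw [junk_apply_of_eq_zero rfl (H t) 0, hH t, translateMulti_apply,
        junk_apply_of_eq_zero rfl (osAdjoint F) 0, junk_apply_of_eq_zero rfl G 0, sub_eq_zero]
      congr 1; exact congrArg _ (Subsingleton.elim _ _)
    · have hG' : TimeSep (translateMulti (t • a) G) :=
        (timeSep_of_isTimeOrdered hG).translate _ (by simp [ha0])
      rw [junk_append_eq_zero hnm.ne' (timeSep_of_isTimeOrdered hF) hG' (hH t)]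
      rcases Nat.eq_zero_or_pos n with rfl | hn
      · have hm : m ≠ 0 := by omega
        rw [junk_timeSep_eq_zero hm (timeSep_of_isTimeOrdered hG)]; simp
      · rw [junk_osAdjoint_timeSep_eq_zero hn.ne' (timeSep_of_isTimeOrdered hF)]; simp
  simp only [hzero]
  exact tendsto_const_nhds

/-- `HasMassGap Δ` for the junk family, for EVERY `Δ` (constant `C = 0`). -/
theorem junk_hasMassGap (Δ : ℝ) : junk.toLabelled.HasMassGap Δ := by
  intro n m k k' F G hF hG
  refine ⟨0, fun t ht H hH => ?_⟩
  simp only [SchwingerFamily.toLabelled_apply, zero_mul]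
  rw [norm_le_zero_iff]
  rcases Nat.eq_zero_or_pos (n + m) with hnm | hnm
  · obtain ⟨rfl, rfl⟩ : n = 0 ∧ m = 0 := by omega
    haveI : IsEmpty (Fin (0 + 0)) := (inferInstance : IsEmpty (Fin 0))
    rw [junk_apply_of_eq_zero rfl H 0, hH, translateMulti_apply,
      junk_apply_of_eq_zero rfl (osAdjoint F) 0, junk_apply_of_eq_zero rfl G 0, sub_eq_zero]
    congr 1; exact congrArg _ (Subsingleton.elim _ _)
  · have hG' : TimeSep (translateMulti (EuclideanSpace.single 0 t) G) :=
      (timeSep_of_isTimeOrdered hG).translate _ (by simpa using ht)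
    rw [junk_append_eq_zero hnm.ne' (timeSep_of_isTimeOrdered hF) hG' hH]
    rcases Nat.eq_zero_or_pos n with rfl | hn
    · have hm : m ≠ 0 := by omega
      rw [junk_timeSep_eq_zero hm (timeSep_of_isTimeOrdered hG)]; simp
    · rw [junk_osAdjoint_timeSep_eq_zero hn.ne' (timeSep_of_isTimeOrdered hF)]; simp

end Summit.QuantumFields.YangMills.Theorems.NPointIsotropy.Negative

end
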